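import Summits.QuantumFields.BalabanUV.Beta.SecondOrderBorderModel
import Summits.QuantumFields.BalabanUV.Beta.WardBorderReflection

/-!
# `BalabanUV.Beta.WardBorderReflectionContact` — binder row D1, (L4): «D1-hRhW-SOCKET-CONSISTENCY» part 2a — THE CONSISTENCY IDENTITY
# FOR THE CANONICAL CONTACT, multiplier legs OFF the reflected axis

HONEST FRAMING (cell charter, verbatim): «discharging BetaPertH makes Balaban's UV stability UNCONDITIONAL — a real
constructive-QFT result; it is NOT the continuum limit and NOT the Clay problem.»  Neutral [folklore] algebra: for ANY effective operator `𝕄`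
and ANY first-order stencil family `S` obeying (H1) the first-order REFLECTION law with the product-chart generator `γ₀·ĉt^α`
(`actS_α S = S + conjV 𝕄 (diagK (γ₀ĉt^α))`, entrywise — an2's `actS_SpureRecAt_zero` for the wall) and (H2) the first-order block WARD law
(`Σ_{y∈B(Y)} divV S y = (−2γ₀) • conjV 𝕄 D_Y` on the border — leaf-06's hLoc0 ∕ g3's `divV_vhSAt_eq_conjV` + `bhKAt_inl_inr_eq_linSymAt` for the
wall), and the scale relation `s·γ₀ = −½`, the block Ward divergence of the CANONICAL CONTACT `canonD 𝕄 S (γ₀ĉt^α)` (an2's K-L1a) at every border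
entry whose multiplier leg is OFF the axis `α` EQUALS the reflection defect of the Ward datum `F_Y(κ′,u′) := conjV (S κ′ u′) D_Y` — the identity
`W_Y(B_α) = G_α` of part 1 (`WardBorderReflection.joint_consistency_necessary`) at those entries.  No statement of Bałaban's papers, no `[cite:]`,
no `def`; instantiates NO binder of the β-function wall (0/4: hW, hR, D1Tel, D1Rep); NOT hW, NOT hR, NOT D1, NOT `BetaPertH`, NOT continuum, NOT Clay.
HONEST DEPENDENCY: continuum YM on T⁴ ⇐ BetaPertH ∧ nine spine estimates (0/9 proved); BetaPertH ⇐ (D1) ∧ (D4) ∧ CAP+tail;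
G-an2-4 gates asym, D1 and NE2/3/4.

CONTENT (generic `d`, odd `Lc`, centred root `ρ_c = toSite (ctrOff (d+1) Lc)`, multiplier legs packed at `Lc • Z`, `D_Y := diagK (½ • Σ_{v∈box} legInd ρ_c (Lc•Y + v))`):
* §1 LEG GEOMETRY UNDER THE REFLECTION: `sref_bref_of_ne`∕`sref_bref_self` (a reflected `β`-bond is based at `sref` of `x` resp. `x + e_α`),
  **`mref_add_ctr`** (`m ≠ α`, odd `Lc`: `mref Lc α m z + ρ_c = sref α (z + ρ_c)` — the CENTRED root is what makes multiplier legs reflect block to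
  block), `blockInd_sref` (`Σ_v [w = Lc • sref α Y + v] = Σ_v [sref α w = Lc•Y + v]`), hence the symbols of `refK_α D_{sref Y}`: `D_Y` on `inl β`
  (`β ≠ α`) and `inr m` (`m ≠ α`) legs, the FACE-SHIFTED `½·N_Y(x + e_α)` on `inl α` legs.
* §2 THE GENERATOR OFF THE AXIS: `ctGen … z (inr m) = 0` (`m ≠ α`), the `κ`-sum and block sum of the `inl` letter `[x = u ∧ β = κ ∧ κ = α]`
  over the divergence stencil = `[β = α]·(N_Y(x + e_α) − N_Y(x))` (face layers).
* §3 `divV_canonD_inl_inr` (the contact's divergence at one site: face letter × `S κ′u′`, second-bond letter × `divV S`, and the `𝕄` cross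
  term) and **`canonD_ward_eq_defect_inl_inr`**: the identity at the entries `(x, inl β; z, inr m)`, `m ≠ α` (both `β = α` — the face-shifted
  fluctuation leg — and `β ≠ α`), from (H1), (H2), `s·γ₀ = −½` — pure algebra after §1–§2.
NOT HERE: the mirror block `(x, inr m; z, inl β)` (part 2a′, legs exchanged, same algebra), the `inr α` legs (part 2b: the generator's `inr` letter
`q¹` and its gauge covariance), and the wall instance by name (part 2c: (H1) := an2's `actS_SpureRecAt_zero`, (H2) := `divV_vhSAt_eq_conjV` +
`bhKAt_inl_inr_eq_linSymAt`, `γ₀ = −Lc⁴∕2`, `s = Lc⁻⁴`).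
Provenance: β sub-cell, D1 formalisation swarm, unit b2b-balaban-beta-d1-formalise-leaf-04 gen 4, 2026-08-20 (v1); no existing file touched.
-/

open Finset
open scoped BigOperators
open Literature.MathematicalPhysics.QuantumFieldTheory
open Literature.MathematicalPhysics.QuantumFieldTheory.Balaban1983to89
open Literature.MathematicalPhysics.QuantumFieldTheory.Balaban1983to89.Beta
open ExpKernelCalculus (MKer)
open AffineAveraging (box toSite)
open AveragingContoursRooted (ctrOff)
open KernelWard (divV)
open AveragingContours (blk off)
open PolarizationSign (reflSign axisReflect)
open KernelReflection (LegMap refK refK_apply)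
open ResolventReflection (sref sref_apply sref_sref sref_add sref_sub bref bref_apply bref_self bref_of_ne mref Φ Φ_r_inl Φ_r_inr Φ_s_inl Φ_s_inr
  reflSign_self reflSign_of_ne reflSign_mul_self axisReflect_unitVec_of_ne axisReflect_unitVec_self bflip bflip_mem sum_box_bflip sref_block)
open OneStepResolventKernel (Fib)
open Summit.QuantumFields.BalabanUV.Beta.TameKernelCalculus
open Summit.QuantumFields.BalabanUV.Beta.ChartConjugation (conjV)
open Summit.QuantumFields.BalabanUV.Beta.BorderedHessian (diagK diagK_apply conjV_diagK_apply ctGen ctGen_inl ctGen_inr)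
open Summit.QuantumFields.BalabanUV.Beta.AveragingWardRootedStencils (legSite legInd legInd_inl legInd_inr)
open Summit.QuantumFields.BalabanUV.Beta.SecondOrderBorderGauge (actS actS_apply actB actB_apply canonD canonD_apply)
open Summit.QuantumFields.BalabanUV.Beta.WardBorderReflection (unitVec_eq)

namespace Summit.QuantumFields.BalabanUV.Beta.WardBorderReflectionContact

noncomputable section

variable {d : ℕ}

/-! ## §1 Leg geometry under the reflection of axis `α` -/

section Geometry

variable (α : Fin (d + 1))

/-- [folklore] `sref α (bref α β x) = x` for `β ≠ α`. -/
theorem sref_bref_of_ne {β : Fin (d + 1)} (h : β ≠ α) (x : Fin (d + 1) → ℤ) : sref α (bref α β x) = x := by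
  rw [bref_of_ne h, sref_sref]

/-- [folklore] `sref α (bref α α x) = x + e_α` (in the `divV` spelling of the unit vector). -/
theorem sref_bref_self (x : Fin (d + 1) → ℤ) : sref α (bref α α x) = x + B6BondElimination.unitVec α := by
  rw [bref_self, sref_sub, sref_sref, axisReflect_unitVec_self, sub_neg_eq_add, unitVec_eq]

/-- [folklore] **THE CENTRED ROOT MAKES MULTIPLIER LEGS REFLECT BLOCK TO BLOCK**: for odd `Lc` and `m ≠ α`,
`mref Lc α m z + ρ_c = sref α (z + ρ_c)` (`2·((Lc−1)/2) = Lc − 1`). -/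
theorem mref_add_ctr {Lc : ℕ} (hLc : Odd Lc) {m : Fin (d + 1)} (hm : m ≠ α) (z : Fin (d + 1) → ℤ) :
    mref Lc α m z + toSite (ctrOff (d + 1) Lc) = sref α (z + toSite (ctrOff (d + 1) Lc)) := by
  obtain ⟨k, hk⟩ := hLc
  have hc : (((Lc - 1) / 2 : ℕ) : ℤ) = k := by
    subst hk
    have : (2 * k + 1 - 1) / 2 = k := by omega
    rw [this]
  funext i
  unfold ResolventReflection.mref
  simp only [Pi.add_apply, sref_apply, AffineAveraging.toSite, AveragingContoursRooted.ctrOff, hc]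
  by_cases hi : i = α
  · subst hi
    simp only [if_true, if_neg hm]
    subst hk; push_cast; ring
  · simp only [if_neg hi]

/-- [folklore] **BLOCK INDICATOR SUMS UNDER THE REFLECTION**: `Σ_{v∈box} [w = Lc • sref α Y + v] = Σ_{v∈box} [sref α w = Lc•Y + v]`
(the block `Y` reflects onto the block `sref α Y`, `sref_block` + `sum_box_bflip`). -/
theorem blockInd_sref (Lc : ℕ) (Y w : Fin (d + 1) → ℤ) :
    ∑ v ∈ box (d + 1) Lc, (if w = (Lc : ℤ) • sref α Y + toSite v then (1 : ℝ) else 0) =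
      ∑ v ∈ box (d + 1) Lc, (if sref α w = (Lc : ℤ) • Y + toSite v then (1 : ℝ) else 0) := by
  rw [← sum_box_bflip α Lc (fun v => if w = (Lc : ℤ) • sref α Y + toSite v then (1 : ℝ) else 0)]
  refine Finset.sum_congr rfl fun v hv => ?_
  have e : (Lc : ℤ) • sref α Y + toSite (bflip α Lc v) = sref α ((Lc : ℤ) • Y + toSite v) := (sref_block α hv Y).symm
  simp only [e]
  have iff : w = sref α ((Lc : ℤ) • Y + toSite v) ↔ sref α w = (Lc : ℤ) • Y + toSite v := by
    constructor
    · intro h; rw [h, sref_sref]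
    · intro h; rw [← h, sref_sref]
  by_cases h : w = sref α ((Lc : ℤ) • Y + toSite v)
  · rw [if_pos h, if_pos (iff.1 h)]
  · rw [if_neg h, if_neg (fun h' => h (iff.2 h'))]

variable (Lc : ℕ) (ρ : Fin (d + 1) → ℤ)

/-- [folklore] The symbol of `D_Y` on a fluctuation leg: `(½ • Σ_v legInd ρ (Lc•Y+v)) w (inl β) = ½ · N_Y(w)`. -/
theorem dSym_inl (Y w : Fin (d + 1) → ℤ) (β : Fin (d + 1)) :
    ((1 / 2 : ℝ) • ∑ v ∈ box (d + 1) Lc, legInd ρ ((Lc : ℤ) • Y + toSite v)) w (Sum.inl β) =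
      (1 / 2 : ℝ) * ∑ v ∈ box (d + 1) Lc, (if w = (Lc : ℤ) • Y + toSite v then (1 : ℝ) else 0) := by
  simp only [Pi.smul_apply, Finset.sum_apply, legInd_inl, smul_eq_mul]

/-- [folklore] The symbol of `D_Y` on a multiplier leg: `(½ • Σ_v legInd ρ (Lc•Y+v)) w (inr m) = ½ · N_Y(w + ρ)`. -/
theorem dSym_inr (Y w : Fin (d + 1) → ℤ) (m : Fin (d + 1)) :
    ((1 / 2 : ℝ) • ∑ v ∈ box (d + 1) Lc, legInd ρ ((Lc : ℤ) • Y + toSite v)) w (Sum.inr m) =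
      (1 / 2 : ℝ) * ∑ v ∈ box (d + 1) Lc, (if w + ρ = (Lc : ℤ) • Y + toSite v then (1 : ℝ) else 0) := by
  simp only [Pi.smul_apply, Finset.sum_apply, legInd_inr, smul_eq_mul]

end Geometry

/-! ## §2 The product-chart generator off the reflected axis -/

section Generator

variable (α : Fin (d + 1)) (Lc : ℕ)

/-- [folklore] The generator is silent on multiplier legs off the axis: `ĉt^α_{κu}(z, inr m) = 0` for `m ≠ α`. -/
theorem ctGen_inr_of_ne {m : Fin (d + 1)} (hm : m ≠ α) (κ : Fin (d + 1)) (u z : Fin (d + 1) → ℤ) :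
    ctGen d α Lc κ u z (Sum.inr m) = 0 := by
  rw [ctGen_inr, if_neg (fun h => hm h.1)]

/-- [folklore] **THE `κ`-SUM OF THE FIELD LETTER OVER THE DIVERGENCE STENCIL** at one site `y`:
`Σ_κ ([x = y − e_κ ∧ β = κ ∧ κ = α] − [x = y ∧ β = κ ∧ κ = α]) = [β = α]·([x + e_α = y] − [x = y])`. -/
theorem sum_fieldLetter_div (x y : Fin (d + 1) → ℤ) (β : Fin (d + 1)) :
    ∑ κ : Fin (d + 1), ((if x = y - B6BondElimination.unitVec κ ∧ β = κ ∧ κ = α then (1 : ℝ) else 0) -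
        (if x = y ∧ β = κ ∧ κ = α then (1 : ℝ) else 0)) =
      if β = α then ((if x + B6BondElimination.unitVec α = y then (1 : ℝ) else 0) - (if x = y then (1 : ℝ) else 0)) else 0 := by
  rw [Finset.sum_eq_single α]
  · by_cases hβ : β = α
    · subst hβ
      have e1 : (x = y - B6BondElimination.unitVec β) ↔ x + B6BondElimination.unitVec β = y := by
        constructor
        · intro h; rw [h, sub_add_cancel]
        · intro h; rw [← h, add_sub_cancel_right]
      simp only [if_true, and_true]
      by_cases h1 : x = y - B6BondElimination.unitVec β
      · rw [if_pos h1, if_pos (e1.1 h1)]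
      · rw [if_neg h1, if_neg (fun h => h1 (e1.2 h))]
    · rw [if_neg hβ, if_neg (fun h => hβ h.2.1), if_neg (fun h => hβ h.2.1), sub_zero]
  · intro κ _ hκ
    rw [if_neg (fun h => hκ h.2.2), if_neg (fun h => hκ h.2.2), sub_zero]
  · intro h; exact absurd (Finset.mem_univ α) h

end Generator

/-! ## §3 The consistency identity at the border entries with the multiplier leg off the axis -/

section Identity

variable (Lc : ℕ) (α : Fin (d + 1)) (γ₀ s : ℝ) (𝕄 : MKer (d + 1) (Fib d))
  (S : Fin (d + 1) → (Fin (d + 1) → ℤ) → MKer (d + 1) (Fib d))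

/-- [folklore] **THE DIVERGENCE OF THE CANONICAL CONTACT AT ONE SITE**, entry `(x, inl β; z, inr m)`, `m ≠ α`:
`Σ_κ (D κ (y−e_κ) κ′ u′ − D κ y κ′ u′)(e) = γ₀·S κ′u′(e)·FL(y) + γ₀·c′·(divV S y)(e) + γ₀²·c′·𝕄(e)·FL(y)`, with the face letter
`FL(y) = [β = α]·([x + e_α = y] − [x = y])` and the second bond's letter `c′ = [x = u′ ∧ β = κ′ ∧ κ′ = α]`. -/
theorem divV_canonD_inl_inr {m : Fin (d + 1)} (hm : m ≠ α) (κ' : Fin (d + 1)) (u' y x z : Fin (d + 1) → ℤ) (β : Fin (d + 1)) :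
    divV (fun κ u => canonD 𝕄 S (fun κ u p c => γ₀ * ctGen d α Lc κ u p c) κ u κ' u') y x z (Sum.inl β) (Sum.inr m) =
      γ₀ * S κ' u' x z (Sum.inl β) (Sum.inr m) *
          (if β = α then ((if x + B6BondElimination.unitVec α = y then (1 : ℝ) else 0) - (if x = y then 1 else 0)) else 0) +
        γ₀ * (if x = u' ∧ β = κ' ∧ κ' = α then (1 : ℝ) else 0) * divV S y x z (Sum.inl β) (Sum.inr m) +
        γ₀ ^ 2 * (if x = u' ∧ β = κ' ∧ κ' = α then (1 : ℝ) else 0) * 𝕄 x z (Sum.inl β) (Sum.inr m) *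
          (if β = α then ((if x + B6BondElimination.unitVec α = y then (1 : ℝ) else 0) - (if x = y then 1 else 0)) else 0) := by
  have hcst : ∀ u : Fin (d + 1) → ℤ, ∀ κ : Fin (d + 1),
      (γ₀ * ctGen d α Lc κ u z (Sum.inr m) - γ₀ * ctGen d α Lc κ u x (Sum.inl β)) =
        γ₀ * (if x = u ∧ β = κ ∧ κ = α then (1 : ℝ) else 0) := by
    intro u κ
    rw [ctGen_inr_of_ne α Lc hm, ctGen_inl]
    split_ifs <;> ring
  have e : ∀ κ : Fin (d + 1), ∀ u : Fin (d + 1) → ℤ,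
      canonD 𝕄 S (fun κ u p c => γ₀ * ctGen d α Lc κ u p c) κ u κ' u' x z (Sum.inl β) (Sum.inr m) =
        γ₀ * S κ' u' x z (Sum.inl β) (Sum.inr m) * (if x = u ∧ β = κ ∧ κ = α then (1 : ℝ) else 0) +
          γ₀ * (if x = u' ∧ β = κ' ∧ κ' = α then (1 : ℝ) else 0) * S κ u x z (Sum.inl β) (Sum.inr m) +
          γ₀ ^ 2 * (if x = u' ∧ β = κ' ∧ κ' = α then (1 : ℝ) else 0) * 𝕄 x z (Sum.inl β) (Sum.inr m) *
            (if x = u ∧ β = κ ∧ κ = α then (1 : ℝ) else 0) := by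
    intro κ u
    rw [canonD_apply, hcst, hcst]
    ring
  simp only [KernelWard.divV, Finset.sum_apply, Pi.sub_apply, e]
  rw [← sum_fieldLetter_div α x y β, Finset.mul_sum, Finset.mul_sum, Finset.mul_sum, ← Finset.sum_add_distrib,
    ← Finset.sum_add_distrib]
  refine Finset.sum_congr rfl fun κ _ => ?_
  ring

/-- [folklore] **THE CONSISTENCY IDENTITY `W_Y(B_α) = G_α` AT THE ENTRIES `(x, inl β; z, inr m)`, `m ≠ α`**, for the canonical contact
`canonD 𝕄 S (γ₀·ĉt^α)` of ANY first-order datum obeying (H1) the reflection law `actS_α S = S + conjV 𝕄 (diagK (γ₀ĉt^α))` and (H2) the block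
Ward law `Σ_{v} divV S (Lc•Y+v) = (−2γ₀) • conjV 𝕄 D_Y` at these entries, with `s·γ₀ = −½` (odd `Lc`, centred root):
`(s • Σ_v divV (κ u ↦ canonD 𝕄 S (γ₀ĉt^α) κ u κ′ u′) (Lc•Y+v)) (x, inl β; z, inr m)
   = (ε_α(κ′) • refK_α (conjV (S κ′ (bref α κ′ u′)) D_{sref α Y}) − conjV (S κ′ u′) D_Y) (x, inl β; z, inr m)`. -/
theorem canonD_ward_eq_defect_inl_inr (hLc : Odd Lc) {m : Fin (d + 1)} (hm : m ≠ α) (hs : s * γ₀ = -(1 / 2 : ℝ))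
    (hlaw : actS Lc α S = fun κ u => S κ u + conjV 𝕄 (diagK fun p c => γ₀ * ctGen d α Lc κ u p c))
    (hward : ∀ (Y x z : Fin (d + 1) → ℤ) (β : Fin (d + 1)),
      (∑ v ∈ box (d + 1) Lc, divV S ((Lc : ℤ) • Y + toSite v)) x z (Sum.inl β) (Sum.inr m) =
        ((-2 * γ₀) • conjV 𝕄 (diagK ((1 / 2 : ℝ) • ∑ v ∈ box (d + 1) Lc,
          legInd (toSite (ctrOff (d + 1) Lc)) ((Lc : ℤ) • Y + toSite v)))) x z (Sum.inl β) (Sum.inr m))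
    (Y : Fin (d + 1) → ℤ) (κ' : Fin (d + 1)) (u' x z : Fin (d + 1) → ℤ) (β : Fin (d + 1)) :
    (s • ∑ v ∈ box (d + 1) Lc, divV (fun κ u => canonD 𝕄 S (fun κ u p c => γ₀ * ctGen d α Lc κ u p c) κ u κ' u')
        ((Lc : ℤ) • Y + toSite v)) x z (Sum.inl β) (Sum.inr m) =
      (reflSign α κ' • refK (Φ (d := d) Lc α) (conjV (S κ' (bref α κ' u'))
          (diagK ((1 / 2 : ℝ) • ∑ v ∈ box (d + 1) Lc, legInd (toSite (ctrOff (d + 1) Lc)) ((Lc : ℤ) • sref α Y + toSite v)))) -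
        conjV (S κ' u') (diagK ((1 / 2 : ℝ) • ∑ v ∈ box (d + 1) Lc, legInd (toSite (ctrOff (d + 1) Lc)) ((Lc : ℤ) • Y + toSite v))))
        x z (Sum.inl β) (Sum.inr m) := by
  -- abbreviations
  set ρ : Fin (d + 1) → ℤ := toSite (ctrOff (d + 1) Lc) with hρ
  set A : ℝ := S κ' u' x z (Sum.inl β) (Sum.inr m) with hA
  set M : ℝ := 𝕄 x z (Sum.inl β) (Sum.inr m) with hM
  set Nx : ℝ := ∑ v ∈ box (d + 1) Lc, (if x = (Lc : ℤ) • Y + toSite v then (1 : ℝ) else 0) with hNx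
  set Nxe : ℝ := ∑ v ∈ box (d + 1) Lc, (if x + B6BondElimination.unitVec α = (Lc : ℤ) • Y + toSite v then (1 : ℝ) else 0) with hNxe
  set Nz : ℝ := ∑ v ∈ box (d + 1) Lc, (if z + ρ = (Lc : ℤ) • Y + toSite v then (1 : ℝ) else 0) with hNz
  -- the `inl` letter of the second bond (a constant of the sums)
  have hcst : ∀ u : Fin (d + 1) → ℤ, ∀ κ : Fin (d + 1),
      (γ₀ * ctGen d α Lc κ u z (Sum.inr m) - γ₀ * ctGen d α Lc κ u x (Sum.inl β)) =
        γ₀ * (if x = u ∧ β = κ ∧ κ = α then (1 : ℝ) else 0) := by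
    intro u κ
    rw [ctGen_inr_of_ne α Lc hm, ctGen_inl]
    split_ifs <;> ring
  -- (H1) at this entry
  have hlaw_e : reflSign α κ' * (reflSign α β * reflSign α m *
      S κ' (bref α κ' u') (bref α β x) (mref Lc α m z) (Sum.inl β) (Sum.inr m)) =
        A + M * (γ₀ * (if x = u' ∧ β = κ' ∧ κ' = α then (1 : ℝ) else 0)) := by
    have e := congrFun (congrFun (congrFun (congrFun (congrFun (congrFun hlaw κ') u') x) z) (Sum.inl β)) (Sum.inr m)
    rw [actS_apply, Φ_s_inl, Φ_s_inr, Φ_r_inl, Φ_r_inr] at e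
    rw [e, Pi.add_apply, Pi.add_apply, Pi.add_apply, Pi.add_apply, conjV_diagK_apply, hcst]
  -- the reflected symbols of `D`
  have hDz : ((1 / 2 : ℝ) • ∑ v ∈ box (d + 1) Lc, legInd ρ ((Lc : ℤ) • sref α Y + toSite v)) (mref Lc α m z) (Sum.inr m) =
      (1 / 2 : ℝ) * Nz := by
    rw [dSym_inr, mref_add_ctr α hLc hm, blockInd_sref, sref_sref]
  have hDx : ((1 / 2 : ℝ) • ∑ v ∈ box (d + 1) Lc, legInd ρ ((Lc : ℤ) • sref α Y + toSite v)) (bref α β x) (Sum.inl β) =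
      (1 / 2 : ℝ) * (if β = α then Nxe else Nx) := by
    rw [dSym_inl, blockInd_sref]
    by_cases hβ : β = α
    · subst hβ; rw [if_pos rfl, sref_bref_self]
    · rw [if_neg hβ, sref_bref_of_ne α hβ]
  have hDz0 : ((1 / 2 : ℝ) • ∑ v ∈ box (d + 1) Lc, legInd ρ ((Lc : ℤ) • Y + toSite v)) z (Sum.inr m) = (1 / 2 : ℝ) * Nz :=
    dSym_inr Lc ρ Y z m
  have hDx0 : ((1 / 2 : ℝ) • ∑ v ∈ box (d + 1) Lc, legInd ρ ((Lc : ℤ) • Y + toSite v)) x (Sum.inl β) = (1 / 2 : ℝ) * Nx :=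
    dSym_inl Lc ρ Y x β
  -- (H2) at this entry
  have hward_e : (∑ v ∈ box (d + 1) Lc, divV S ((Lc : ℤ) • Y + toSite v)) x z (Sum.inl β) (Sum.inr m) =
      (-2 * γ₀) * (M * ((1 / 2 : ℝ) * Nz - (1 / 2 : ℝ) * Nx)) := by
    rw [hward, Pi.smul_apply, Pi.smul_apply, Pi.smul_apply, Pi.smul_apply, smul_eq_mul, conjV_diagK_apply, hDz0, hDx0]
  -- LHS: expand the block Ward sum of the canonical contact
  have hL : (∑ v ∈ box (d + 1) Lc, divV (fun κ u => canonD 𝕄 S (fun κ u p c => γ₀ * ctGen d α Lc κ u p c) κ u κ' u')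
      ((Lc : ℤ) • Y + toSite v)) x z (Sum.inl β) (Sum.inr m) =
      γ₀ * A * (if β = α then Nxe - Nx else 0) +
        γ₀ * (if x = u' ∧ β = κ' ∧ κ' = α then (1 : ℝ) else 0) *
          ((∑ v ∈ box (d + 1) Lc, divV S ((Lc : ℤ) • Y + toSite v)) x z (Sum.inl β) (Sum.inr m)) +
        γ₀ ^ 2 * (if x = u' ∧ β = κ' ∧ κ' = α then (1 : ℝ) else 0) * M * (if β = α then Nxe - Nx else 0) := by
    simp only [Finset.sum_apply, divV_canonD_inl_inr Lc α γ₀ 𝕄 S hm, ← hA, ← hM]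
    rw [Finset.sum_add_distrib, Finset.sum_add_distrib, ← Finset.mul_sum, ← Finset.mul_sum, ← Finset.mul_sum]
    have hFL : ∑ v ∈ box (d + 1) Lc,
        (if β = α then ((if x + B6BondElimination.unitVec α = (Lc : ℤ) • Y + toSite v then (1 : ℝ) else 0) -
          (if x = (Lc : ℤ) • Y + toSite v then 1 else 0)) else 0) = if β = α then Nxe - Nx else 0 := by
      by_cases hβ : β = α
      · simp only [if_pos hβ, Finset.sum_sub_distrib, hNxe, hNx]
      · simp only [if_neg hβ, Finset.sum_const_zero]
    rw [hFL]
  -- assemble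
  have hγ : γ₀ ≠ 0 := by
    rintro rfl; norm_num at hs
  have hs' : s = -(1 / 2 : ℝ) / γ₀ := by
    field_simp; linarith [hs]
  rw [Pi.smul_apply, Pi.smul_apply, Pi.smul_apply, Pi.smul_apply, smul_eq_mul, hL, hward_e]
  rw [Pi.sub_apply, Pi.sub_apply, Pi.sub_apply, Pi.sub_apply, Pi.smul_apply, Pi.smul_apply, Pi.smul_apply, Pi.smul_apply,
    smul_eq_mul, refK_apply, Φ_s_inl, Φ_s_inr, Φ_r_inl, Φ_r_inr, conjV_diagK_apply, conjV_diagK_apply, hDz, hDx, hDz0, hDx0,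
    ← hA]
  rw [show reflSign α κ' * (reflSign α β * reflSign α m *
      (S κ' (bref α κ' u') (bref α β x) (mref Lc α m z) (Sum.inl β) (Sum.inr m) * ((1 / 2 : ℝ) * Nz - (1 / 2 : ℝ) * (if β = α then Nxe else Nx)))) =
      (reflSign α κ' * (reflSign α β * reflSign α m * S κ' (bref α κ' u') (bref α β x) (mref Lc α m z) (Sum.inl β) (Sum.inr m))) *
        ((1 / 2 : ℝ) * Nz - (1 / 2 : ℝ) * (if β = α then Nxe else Nx)) by ring, hlaw_e, hs']
  by_cases hβ : β = α
  · simp only [if_pos hβ]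
    field_simp
    ring
  · have hc : ¬(x = u' ∧ β = κ' ∧ κ' = α) := fun h => hβ (h.2.1.trans h.2.2)
    simp only [if_neg hβ, if_neg hc]
    ring

end Identity

end

end Summit.QuantumFields.BalabanUV.Beta.WardBorderReflectionContact
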